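import Summits.CriticalPhenomena.PercolationContinuityZ3.Theorems.PercNearOneGluingNoHeavyPcintBSMXLaw
import Mathlib.Analysis.SpecialFunctions.Gaussian.GaussianIntegral
import Mathlib.Analysis.SpecialFunctions.Integrals.Basic
import HarnessLib

/-!
# PCINT lane, PHASE 7 (sharp dispersion): the Fourier representation of the five-point convolution and its Laplace bound

Cell `prim-pcint`, seat `prim-pcint-1` (gen 16); memo `run/shared/lean/prim/pcint/T-FIBRE-ROUTE.md` §PHASE 7.

The `n`-fold convolution `BSMX.H a₁ a₂ n` of the symmetric five-point law (…PcintBSMXLaw) has the Fourier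
representation `2π · H n δ = ∫_{-π}^{π} φ(θ)ⁿ cos(δθ) dθ` with the (real) symbol
`φ(θ) = (1 - 2a₁ - 2a₂) + 2a₁ cos θ + 2a₂ cos 2θ` (**`BSMX.integral_sym_pow_mul_cos`**, by induction on `n` with the
product-to-sum formula and `∫_{-π}^{π} cos(mθ) dθ = 2π 𝟙[m = 0]`).  When `4a₁ + 4a₂ ≤ 1` the symbol is nonnegative, so
`H n δ ≤ (2π)⁻¹ ∫ φⁿ`, and Laplace's method with explicit constants gives the near-sharp local-limit bound
**`BSMX.H_le_fourier`**: for `0 < θ₀ ≤ 1/2`, `0 < c ≤ (a₁ + 4a₂) - (5/48)(a₁ + 16a₂) θ₀²`,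
`m ≤ 2a₁ L(θ₀) + 2a₂ L(2θ₀)` and `m ≤ 2a₁` (`L(x) = x²/2 - (5/96) x⁴ ≤ 1 - cos x` on `|x| ≤ 1`, `Real.cos_bound`), every `n ≥ 1`:

  `H a₁ a₂ n δ ≤ 1 / (2 √(π c n)) + exp (-m n)`.

(Pointwise `φⁿ ≤ exp(-n(1-φ)) ≤ exp(-n c θ²)` on `|θ| ≤ θ₀`, `≤ exp(-n m)` elsewhere on `[-π, π]`, then the Gaussian
integral `∫ exp(-b θ²) = √(π/b)`.)  The constant `1/(2√(π c))` with `c → (a₁ + 4a₂) = σ²/2` is the local central limit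
constant `1/√(2π σ² n)`; it replaces the combinatorial `1/√(8 a₁ n)` of …PcintBSMXDisp in the Green tails (…PcintBSMXFourierTail).
-/

noncomputable section

namespace Summit.CriticalPhenomena.PercolationContinuityZ3.Theorems.Pcint.BSMX

open Finset Real MeasureTheory intervalIntegral Set

/-! ### The symbol -/

/-- **The symbol of the five-point law**: `φ(θ) = Σ_c g₅ c · cos (val5 c · θ)`. -/
def sym (a₁ a₂ : ℝ) (θ : ℝ) : ℝ := ∑ c : Fin 5, g₅ a₁ a₂ c * Real.cos (val5 c * θ)

/-- Closed form: `φ(θ) = (1 - 2a₁ - 2a₂) + 2a₁ cos θ + 2a₂ cos 2θ`. -/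
theorem sym_eq (a₁ a₂ θ : ℝ) :
    sym a₁ a₂ θ = (1 - 2 * a₁ - 2 * a₂) + 2 * a₁ * Real.cos θ + 2 * a₂ * Real.cos (2 * θ) := by
  unfold sym
  rw [Fin.sum_univ_five, (g₅_apply a₁ a₂).1, (g₅_apply a₁ a₂).2.1, (g₅_apply a₁ a₂).2.2.1,
    (g₅_apply a₁ a₂).2.2.2.1, (g₅_apply a₁ a₂).2.2.2.2, val5_apply.1, val5_apply.2.1, val5_apply.2.2.1,
    val5_apply.2.2.2.1, val5_apply.2.2.2.2]
  push_cast
  rw [show ((-2 : ℝ)) * θ = -(2 * θ) by ring, show ((-1 : ℝ)) * θ = -θ by ring, Real.cos_neg, Real.cos_neg,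
    zero_mul, Real.cos_zero, one_mul]
  ring

/-- The symbol is continuous. -/
theorem continuous_sym (a₁ a₂ : ℝ) : Continuous (sym a₁ a₂) := by
  have : sym a₁ a₂ = fun θ => (1 - 2 * a₁ - 2 * a₂) + 2 * a₁ * Real.cos θ + 2 * a₂ * Real.cos (2 * θ) :=
    funext (sym_eq a₁ a₂)
  rw [this]
  fun_prop

/-- `1 - φ(θ) = 2a₁ (1 - cos θ) + 2a₂ (1 - cos 2θ)`. -/
theorem one_sub_sym (a₁ a₂ θ : ℝ) :
    1 - sym a₁ a₂ θ = 2 * a₁ * (1 - Real.cos θ) + 2 * a₂ * (1 - Real.cos (2 * θ)) := by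
  rw [sym_eq]; ring

/-- `φ ≤ 1` (for `a₁, a₂ ≥ 0`). -/
theorem sym_le_one {a₁ a₂ : ℝ} (h1 : 0 ≤ a₁) (h2 : 0 ≤ a₂) (θ : ℝ) : sym a₁ a₂ θ ≤ 1 := by
  have := one_sub_sym a₁ a₂ θ
  have c1 := Real.cos_le_one θ
  have c2 := Real.cos_le_one (2 * θ)
  nlinarith [mul_nonneg h1 (sub_nonneg.2 c1), mul_nonneg h2 (sub_nonneg.2 c2)]

/-- **`φ ≥ 0` when `4a₁ + 4a₂ ≤ 1`** (the weight at `0` dominates). -/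
theorem sym_nonneg {a₁ a₂ : ℝ} (h1 : 0 ≤ a₁) (h2 : 0 ≤ a₂) (h : 4 * a₁ + 4 * a₂ ≤ 1) (θ : ℝ) : 0 ≤ sym a₁ a₂ θ := by
  rw [sym_eq]
  have c1 := Real.neg_one_le_cos θ
  have c2 := Real.neg_one_le_cos (2 * θ)
  nlinarith [mul_nonneg h1 (by linarith : 0 ≤ Real.cos θ + 1), mul_nonneg h2 (by linarith : 0 ≤ Real.cos (2 * θ) + 1)]

/-! ### The Fourier representation -/

/-- The symbol times a cosine: `φ(θ) cos(δθ) = Σ_c (g₅ c / 2) (cos((δ - v_c)θ) + cos((δ + v_c)θ))`. -/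
theorem sym_mul_cos (a₁ a₂ : ℝ) (δ : ℤ) (θ : ℝ) : sym a₁ a₂ θ * Real.cos (δ * θ) =
    ∑ c : Fin 5, g₅ a₁ a₂ c / 2 * (Real.cos (((δ - val5 c : ℤ) : ℝ) * θ) + Real.cos (((δ + val5 c : ℤ) : ℝ) * θ)) := by
  -- product-to-sum `cos a cos b = (cos (a - b) + cos (a + b)) / 2`
  have pts : ∀ a b : ℝ, Real.cos a * Real.cos b = (Real.cos (a - b) + Real.cos (a + b)) / 2 := fun a b => by
    rw [Real.cos_sub, Real.cos_add]; ring
  unfold sym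
  rw [sum_mul]
  refine sum_congr rfl fun c _ => ?_
  rw [mul_assoc, pts (val5 c * θ) (δ * θ)]
  push_cast
  rw [show (val5 c : ℝ) * θ - δ * θ = -((δ - val5 c) * θ) by ring, Real.cos_neg,
    show (val5 c : ℝ) * θ + δ * θ = (δ + val5 c) * θ by ring]
  ring

/-- One step of the symbol recursion under the integral sign (pointwise):
`φ^{n+1} cos(δθ) = Σ_c (g₅ c / 2) (φⁿ cos((δ - v_c)θ)) + Σ_c (g₅ c / 2) (φⁿ cos((δ + v_c)θ))`. -/
theorem sym_pow_succ_mul_cos (a₁ a₂ : ℝ) (n : ℕ) (δ : ℤ) (θ : ℝ) :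
    sym a₁ a₂ θ ^ (n + 1) * Real.cos (δ * θ) =
      (∑ c : Fin 5, g₅ a₁ a₂ c / 2 * (sym a₁ a₂ θ ^ n * Real.cos (((δ - val5 c : ℤ) : ℝ) * θ))) +
        ∑ c : Fin 5, g₅ a₁ a₂ c / 2 * (sym a₁ a₂ θ ^ n * Real.cos (((δ + val5 c : ℤ) : ℝ) * θ)) := by
  rw [pow_succ, mul_assoc, sym_mul_cos, mul_sum, ← sum_add_distrib]
  refine sum_congr rfl fun c _ => ?_
  ring

/-- **The Fourier representation**: `∫_{-π}^{π} φ(θ)ⁿ cos(δθ) dθ = 2π · H a₁ a₂ n δ`. -/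
theorem integral_sym_pow_mul_cos (a₁ a₂ : ℝ) : ∀ (n : ℕ) (δ : ℤ),
    ∫ θ in (-π)..π, sym a₁ a₂ θ ^ n * Real.cos (δ * θ) = 2 * π * H a₁ a₂ n δ
  | 0, δ => by
    simp_rw [pow_zero, one_mul]
    -- `∫_{-π}^{π} cos (δ θ) dθ = 2π 𝟙[δ = 0]`
    rw [H_zero]
    split_ifs with hδ
    · rw [hδ]; simp only [Int.cast_zero, zero_mul, Real.cos_zero]
      rw [intervalIntegral.integral_const, smul_eq_mul]; ring
    · have hδ' : (δ : ℝ) ≠ 0 := by exact_mod_cast hδ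
      rw [intervalIntegral.integral_comp_mul_left (fun x => Real.cos x) hδ', integral_cos,
        show (δ : ℝ) * -π = -(δ * π) by ring, Real.sin_neg, Real.sin_int_mul_pi]
      simp
  | n + 1, δ => by
    have hc := continuous_sym a₁ a₂
    have hint : ∀ (e : ℤ), IntervalIntegrable (fun θ => sym a₁ a₂ θ ^ n * Real.cos ((e : ℝ) * θ)) volume (-π) π :=
      fun e => (Continuous.intervalIntegrable (by fun_prop) _ _)
    simp_rw [sym_pow_succ_mul_cos a₁ a₂ n δ]
    rw [intervalIntegral.integral_add, intervalIntegral.integral_finsetSum, intervalIntegral.integral_finsetSum]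
    · simp_rw [intervalIntegral.integral_const_mul, integral_sym_pow_mul_cos a₁ a₂ n]
      -- `H_succ` and `H_succ'` give the same value; average them
      have s1 : ∑ c : Fin 5, g₅ a₁ a₂ c / 2 * (2 * π * H a₁ a₂ n (δ - val5 c)) =
          π * ∑ c : Fin 5, g₅ a₁ a₂ c * H a₁ a₂ n (δ - val5 c) := by
        rw [mul_sum]; exact sum_congr rfl fun c _ => by ring
      have s2 : ∑ c : Fin 5, g₅ a₁ a₂ c / 2 * (2 * π * H a₁ a₂ n (δ + val5 c)) =
          π * ∑ c : Fin 5, g₅ a₁ a₂ c * H a₁ a₂ n (δ + val5 c) := by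
        rw [mul_sum]; exact sum_congr rfl fun c _ => by ring
      rw [s1, s2, ← H_succ, ← H_succ']
      ring
    · exact fun c _ => (hint _).const_mul _
    · exact fun c _ => (hint _).const_mul _
    · exact (continuous_finsetSum _ fun c _ => (by fun_prop : Continuous fun θ =>
        g₅ a₁ a₂ c / 2 * (sym a₁ a₂ θ ^ n * Real.cos (((δ - val5 c : ℤ) : ℝ) * θ)))).intervalIntegrable _ _
    · exact (continuous_finsetSum _ fun c _ => (by fun_prop : Continuous fun θ =>
        g₅ a₁ a₂ c / 2 * (sym a₁ a₂ θ ^ n * Real.cos (((δ + val5 c : ℤ) : ℝ) * θ)))).intervalIntegrable _ _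

/-- The Fourier representation solved for `H`: `H n δ = (2π)⁻¹ ∫_{-π}^{π} φⁿ cos(δθ)`. -/
theorem H_eq_integral (a₁ a₂ : ℝ) (n : ℕ) (δ : ℤ) :
    H a₁ a₂ n δ = (∫ θ in (-π)..π, sym a₁ a₂ θ ^ n * Real.cos (δ * θ)) / (2 * π) := by
  rw [integral_sym_pow_mul_cos, mul_div_cancel_left₀ _ (by positivity : (2 : ℝ) * π ≠ 0)]

/-! ### Pointwise bounds for the symbol -/

/-- `Lcos x = x²/2 - (5/96) x⁴`, a lower bound for `1 - cos x` on `|x| ≤ 1` (`Real.cos_bound`). -/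
def Lcos (x : ℝ) : ℝ := x ^ 2 / 2 - 5 / 96 * x ^ 4

/-- `Lcos x ≤ 1 - cos x` for `|x| ≤ 1`. -/
theorem Lcos_le {x : ℝ} (hx : |x| ≤ 1) : Lcos x ≤ 1 - Real.cos x := by
  have h := Real.cos_bound hx
  rw [abs_le] at h
  have h4 : |x| ^ 4 = x ^ 4 := by rw [pow_abs]; exact abs_of_nonneg (by positivity)
  unfold Lcos
  linarith [h.2]

/-- **Region A** (`|θ| ≤ θ₀ ≤ 1/2`): `1 - φ(θ) ≥ c θ²` whenever `c ≤ (a₁ + 4a₂) - (5/48)(a₁ + 16a₂) θ₀²`. -/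
theorem sq_mul_le_one_sub_sym {a₁ a₂ θ₀ c θ : ℝ} (h1 : 0 ≤ a₁) (h2 : 0 ≤ a₂) (hθ₀ : θ₀ ≤ 1 / 2)
    (hc : c ≤ (a₁ + 4 * a₂) - 5 / 48 * (a₁ + 16 * a₂) * θ₀ ^ 2) (hθ : |θ| ≤ θ₀) :
    c * θ ^ 2 ≤ 1 - sym a₁ a₂ θ := by
  have hθ1 : |θ| ≤ 1 := by linarith
  have hθ2 : |2 * θ| ≤ 1 := by rw [abs_mul, abs_two]; linarith
  have l1 := Lcos_le hθ1
  have l2 := Lcos_le hθ2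
  unfold Lcos at l1 l2
  rw [one_sub_sym]
  have hsq : θ ^ 2 ≤ θ₀ ^ 2 := by
    have := sq_abs θ; rw [← this]; exact pow_le_pow_left₀ (abs_nonneg θ) hθ 2
  have ht2 : 0 ≤ θ ^ 2 := sq_nonneg θ
  -- `2a₁ L(θ) + 2a₂ L(2θ) = (a₁ + 4a₂) θ² - ((5/48) a₁ + (5/3) a₂) θ⁴ ≥ c θ²`
  have key : c * θ ^ 2 ≤ 2 * a₁ * (θ ^ 2 / 2 - 5 / 96 * θ ^ 4) + 2 * a₂ * ((2 * θ) ^ 2 / 2 - 5 / 96 * (2 * θ) ^ 4) := by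
    have e : 2 * a₁ * (θ ^ 2 / 2 - 5 / 96 * θ ^ 4) + 2 * a₂ * ((2 * θ) ^ 2 / 2 - 5 / 96 * (2 * θ) ^ 4) - c * θ ^ 2 =
        θ ^ 2 * ((a₁ + 4 * a₂ - c) - 5 / 48 * (a₁ + 16 * a₂) * θ ^ 2) := by ring
    have : 0 ≤ θ ^ 2 * ((a₁ + 4 * a₂ - c) - 5 / 48 * (a₁ + 16 * a₂) * θ ^ 2) := by
      apply mul_nonneg ht2
      have : 0 ≤ 5 / 48 * (a₁ + 16 * a₂) * (θ₀ ^ 2 - θ ^ 2) := by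
        apply mul_nonneg (by positivity); linarith
      linarith
    linarith
  nlinarith [mul_le_mul_of_nonneg_left l1 (by positivity : (0 : ℝ) ≤ 2 * a₁),
    mul_le_mul_of_nonneg_left l2 (by positivity : (0 : ℝ) ≤ 2 * a₂)]

/-- **Regions B and C** (`θ₀ ≤ |θ| ≤ π`): `1 - φ(θ) ≥ m` whenever `m ≤ 2a₁ L(θ₀) + 2a₂ L(2θ₀)` and `m ≤ 2a₁`. -/
theorem le_one_sub_sym {a₁ a₂ θ₀ m θ : ℝ} (h1 : 0 ≤ a₁) (h2 : 0 ≤ a₂) (hθ₀0 : 0 ≤ θ₀) (hθ₀ : θ₀ ≤ 1 / 2)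
    (hmB : m ≤ 2 * a₁ * Lcos θ₀ + 2 * a₂ * Lcos (2 * θ₀)) (hmC : m ≤ 2 * a₁) (hθ1 : θ₀ ≤ |θ|) (hθ2 : |θ| ≤ π) :
    m ≤ 1 - sym a₁ a₂ θ := by
  rw [one_sub_sym, ← Real.cos_abs θ, show 2 * θ = 2 * θ by rfl, ← Real.cos_abs (2 * θ), abs_mul, abs_two]
  rcases le_or_gt |θ| (π / 2) with hB | hC
  · -- region B: `cos |θ| ≤ cos θ₀`, `cos 2|θ| ≤ cos 2θ₀`
    have c1 : Real.cos |θ| ≤ Real.cos θ₀ := Real.cos_le_cos_of_nonneg_of_le_pi hθ₀0 hθ2 hθ1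
    have c2 : Real.cos (2 * |θ|) ≤ Real.cos (2 * θ₀) :=
      Real.cos_le_cos_of_nonneg_of_le_pi (by linarith) (by linarith) (by linarith)
    have l1 := Lcos_le (x := θ₀) (by rw [abs_of_nonneg hθ₀0]; linarith)
    have l2 := Lcos_le (x := 2 * θ₀) (by rw [abs_of_nonneg (by linarith)]; linarith)
    nlinarith [mul_le_mul_of_nonneg_left c1 (by positivity : (0 : ℝ) ≤ 2 * a₁),
      mul_le_mul_of_nonneg_left c2 (by positivity : (0 : ℝ) ≤ 2 * a₂),
      mul_le_mul_of_nonneg_left l1 (by positivity : (0 : ℝ) ≤ 2 * a₁),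
      mul_le_mul_of_nonneg_left l2 (by positivity : (0 : ℝ) ≤ 2 * a₂)]
  · -- region C: `cos |θ| ≤ 0`
    have c1 : Real.cos |θ| ≤ 0 := Real.cos_nonpos_of_pi_div_two_le_of_le hC.le (by linarith)
    have c2 : Real.cos (2 * |θ|) ≤ 1 := Real.cos_le_one _
    nlinarith [mul_le_mul_of_nonneg_left c2 (by positivity : (0 : ℝ) ≤ 2 * a₂), mul_nonneg h1 (neg_nonneg.2 c1)]

/-- `sⁿ ≤ exp(-n(1-s))` for `s ≥ 0` (from `s ≤ exp(s-1)`). -/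
theorem pow_le_exp_neg {s : ℝ} (hs : 0 ≤ s) (n : ℕ) : s ^ n ≤ Real.exp (-((n : ℝ) * (1 - s))) := by
  have h1 : s ≤ Real.exp (s - 1) := by have := Real.add_one_le_exp (s - 1); linarith
  calc s ^ n ≤ Real.exp (s - 1) ^ n := pow_le_pow_left₀ hs h1 n
    _ = Real.exp ((n : ℝ) * (s - 1)) := (Real.exp_nat_mul _ _).symm
    _ = Real.exp (-((n : ℝ) * (1 - s))) := by ring_nf

/-- **The pointwise bound on `[-π, π]`**: `φ(θ)ⁿ ≤ exp(-(n c) θ²) + exp(-(n m))`. -/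
theorem sym_pow_le {a₁ a₂ θ₀ c m : ℝ} (h1 : 0 ≤ a₁) (h2 : 0 ≤ a₂) (h4 : 4 * a₁ + 4 * a₂ ≤ 1) (hθ₀0 : 0 ≤ θ₀)
    (hθ₀ : θ₀ ≤ 1 / 2) (hc : c ≤ (a₁ + 4 * a₂) - 5 / 48 * (a₁ + 16 * a₂) * θ₀ ^ 2)
    (hmB : m ≤ 2 * a₁ * Lcos θ₀ + 2 * a₂ * Lcos (2 * θ₀)) (hmC : m ≤ 2 * a₁) (n : ℕ) {θ : ℝ} (hθ : |θ| ≤ π) :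
    sym a₁ a₂ θ ^ n ≤ Real.exp (-((n : ℝ) * c) * θ ^ 2) + Real.exp (-((n : ℝ) * m)) := by
  have hs := sym_nonneg h1 h2 h4 θ
  have h0 := pow_le_exp_neg hs n
  have eA := Real.exp_pos (-((n : ℝ) * c) * θ ^ 2)
  have eB := Real.exp_pos (-((n : ℝ) * m))
  rcases le_or_gt |θ| θ₀ with hA | hBC
  · have hq := sq_mul_le_one_sub_sym h1 h2 hθ₀ hc hA
    have : Real.exp (-((n : ℝ) * (1 - sym a₁ a₂ θ))) ≤ Real.exp (-((n : ℝ) * c) * θ ^ 2) := by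
      rw [Real.exp_le_exp]
      have := mul_le_mul_of_nonneg_left hq (Nat.cast_nonneg n)
      linarith
    linarith
  · have hq := le_one_sub_sym h1 h2 hθ₀0 hθ₀ hmB hmC hBC.le hθ
    have : Real.exp (-((n : ℝ) * (1 - sym a₁ a₂ θ))) ≤ Real.exp (-((n : ℝ) * m)) := by
      rw [Real.exp_le_exp]
      have := mul_le_mul_of_nonneg_left hq (Nat.cast_nonneg n)
      linarith
    linarith

/-! ### The Laplace bound -/

/-- The Gaussian integral over `[-π, π]` is at most the full one: `∫_{-π}^{π} exp(-b θ²) dθ ≤ √(π/b)`. -/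
theorem integral_exp_neg_mul_sq_le {b : ℝ} (hb : 0 < b) :
    ∫ θ in (-π)..π, Real.exp (-b * θ ^ 2) ≤ Real.sqrt (π / b) := by
  rw [intervalIntegral.integral_of_le (by linarith [Real.pi_pos] : -π ≤ π), ← integral_gaussian b]
  exact setIntegral_le_integral (integrable_exp_neg_mul_sq hb) (Filter.Eventually.of_forall fun x => (Real.exp_pos _).le)

/-- `√(π/(n c)) / (2π) = 1 / (2 √(π c n))`. -/
theorem sqrt_div_two_pi {c n : ℝ} (hc : 0 < c) (hn : 0 < n) :
    Real.sqrt (π / (n * c)) / (2 * π) = 1 / (2 * Real.sqrt (π * c * n)) := by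
  have hπ := Real.pi_pos
  have hs : 0 < Real.sqrt (π * c * n) := Real.sqrt_pos.2 (by positivity)
  have e : Real.sqrt (π / (n * c)) = π / Real.sqrt (π * c * n) := by
    rw [eq_div_iff hs.ne', ← Real.sqrt_mul (by positivity)]
    rw [show π / (n * c) * (π * c * n) = π ^ 2 by field_simp]
    exact Real.sqrt_sq hπ.le
  rw [e]
  field_simp

/-- **The near-sharp dispersion bound (Laplace's method on the Fourier representation)**: for admissible parameters with
`4a₁ + 4a₂ ≤ 1`, `0 < θ₀ ≤ 1/2`, `0 < c ≤ (a₁ + 4a₂) - (5/48)(a₁ + 16a₂) θ₀²`, `m ≤ 2a₁ L(θ₀) + 2a₂ L(2θ₀)`, `m ≤ 2a₁`,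
and every `n ≥ 1`, `δ`:  `H a₁ a₂ n δ ≤ 1 / (2 √(π c n)) + exp(-m n)`. -/
theorem H_le_fourier {a₁ a₂ θ₀ c m : ℝ} (h : Adm a₁ a₂) (h4 : 4 * a₁ + 4 * a₂ ≤ 1) (hθ₀0 : 0 < θ₀)
    (hθ₀ : θ₀ ≤ 1 / 2) (hc0 : 0 < c) (hc : c ≤ (a₁ + 4 * a₂) - 5 / 48 * (a₁ + 16 * a₂) * θ₀ ^ 2)
    (hmB : m ≤ 2 * a₁ * Lcos θ₀ + 2 * a₂ * Lcos (2 * θ₀)) (hmC : m ≤ 2 * a₁) {n : ℕ} (hn : 1 ≤ n) (δ : ℤ) :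
    H a₁ a₂ n δ ≤ 1 / (2 * Real.sqrt (π * c * n)) + Real.exp (-(m * n)) := by
  have hπ := Real.pi_pos
  have h1 := h.a₁_nonneg
  have h2 := h.nonneg
  have hnR : (0 : ℝ) < n := by exact_mod_cast hn
  have hb : 0 < (n : ℝ) * c := by positivity
  have hcs := continuous_sym a₁ a₂
  -- pointwise: `φⁿ cos(δθ) ≤ exp(-(nc) θ²) + exp(-(nm))` on `[-π, π]`
  have hpt : ∀ θ ∈ Icc (-π) π, sym a₁ a₂ θ ^ n * Real.cos (δ * θ) ≤
      Real.exp (-((n : ℝ) * c) * θ ^ 2) + Real.exp (-((n : ℝ) * m)) := by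
    intro θ hθ
    have habs : |θ| ≤ π := abs_le.2 ⟨hθ.1, hθ.2⟩
    have hsn : 0 ≤ sym a₁ a₂ θ ^ n := pow_nonneg (sym_nonneg h1 h2 h4 θ) n
    calc sym a₁ a₂ θ ^ n * Real.cos (δ * θ) ≤ sym a₁ a₂ θ ^ n * 1 :=
          mul_le_mul_of_nonneg_left (Real.cos_le_one _) hsn
      _ ≤ _ := by rw [mul_one]; exact sym_pow_le h1 h2 h4 hθ₀0.le hθ₀ hc hmB hmC n habs
  have hmono : ∫ θ in (-π)..π, sym a₁ a₂ θ ^ n * Real.cos (δ * θ) ≤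
      ∫ θ in (-π)..π, (Real.exp (-((n : ℝ) * c) * θ ^ 2) + Real.exp (-((n : ℝ) * m))) :=
    intervalIntegral.integral_mono_on (by linarith) ((by fun_prop : Continuous fun θ =>
      sym a₁ a₂ θ ^ n * Real.cos (δ * θ)).intervalIntegrable _ _)
      ((by fun_prop : Continuous fun θ : ℝ =>
        Real.exp (-((n : ℝ) * c) * θ ^ 2) + Real.exp (-((n : ℝ) * m))).intervalIntegrable _ _) hpt
  have hsplit : ∫ θ in (-π)..π, (Real.exp (-((n : ℝ) * c) * θ ^ 2) + Real.exp (-((n : ℝ) * m))) =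
      (∫ θ in (-π)..π, Real.exp (-((n : ℝ) * c) * θ ^ 2)) + 2 * π * Real.exp (-((n : ℝ) * m)) := by
    rw [intervalIntegral.integral_add ((by fun_prop : Continuous fun θ : ℝ =>
        Real.exp (-((n : ℝ) * c) * θ ^ 2)).intervalIntegrable _ _) (intervalIntegrable_const),
      intervalIntegral.integral_const, smul_eq_mul]
    ring
  have hg := integral_exp_neg_mul_sq_le hb
  rw [H_eq_integral, div_le_iff₀ (by positivity : (0 : ℝ) < 2 * π)]
  calc ∫ θ in (-π)..π, sym a₁ a₂ θ ^ n * Real.cos (δ * θ)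
      ≤ Real.sqrt (π / ((n : ℝ) * c)) + 2 * π * Real.exp (-((n : ℝ) * m)) := by rw [hsplit] at hmono; linarith
    _ = (1 / (2 * Real.sqrt (π * c * n)) + Real.exp (-(m * n))) * (2 * π) := by
        rw [← sqrt_div_two_pi hc0 hnR, show -(m * (n : ℝ)) = -((n : ℝ) * m) by ring]
        field_simp

end Summit.CriticalPhenomena.PercolationContinuityZ3.Theorems.Pcint.BSMX

end
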